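import Summits.HodgeConjecture.HodgeConjecture.Theorems.NikulinTwinTransportSquareGlueDegreeFour
import Literature.AlgebraicGeometry.HodgeTheory.HodgeIndexPrimitiveAlgebraicHolds
import Literature.AlgebraicGeometry.HodgeTheory.LefschetzOneOneHolds
import Literature.AlgebraicGeometry.HodgeTheory.AlgebraicClassesHodgeTypeHolds
import Literature.AlgebraicGeometry.HodgeTheory.CanonicalTrace
import Literature.AlgebraicGeometry.HodgeTheory.HodgeClassOfMorphismProofs
import Literature.AlgebraicGeometry.HodgeTheory.VanishingCohomologyNontrivialProofs
import Literature.AlgebraicGeometry.HodgeTheory.SupportedClassesRationalProofs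
import Literature.NumberTheory.Transcendental.DeRhamTheoremMultiplicative
import Mathlib.LinearAlgebra.Matrix.NonsingularInverse

/-!
# Route NikulinTwinTransport · `SquareGlue` (stmt-HodgeConjecture-13682) — marking-free bookkeeping I:
# the Néron–Severi projection of `H²` of ANY smooth projective surface

The landed conditional proof of the glue item `SquareGlue` (`squareGlue_of_facts`,
`NikulinTwinTransportSquareGlue.lean`) reads the decomposition `H²(S) = NS ⊕ T` through a MARKING of the
K3 lattice (named fact `Huybrechts_K3_marking_exists`, not discharged) and uses `b₁(S) = 0`
(`Huybrechts_K3_oddBetti_vanish`, GAGA-blocked). This file is the first of three replacing both inputs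
by fact-free arguments valid for EVERY smooth projective complex surface `S`:

* `exists_neronSeveri_gramBasis` — `N = N¹H²(S(ℂ); ℂ) = algebraicClasses S 1` has a `ℂ`-basis of
  RATIONAL classes `d₁, …, d_r` whose Gram matrix `G = (∫_S dᵢ ∪ dⱼ) ∈ M_r(ℚ)` is invertible: a rational
  class of `N` orthogonal to `N` is orthogonal to the ample class and to itself, hence zero by the Hodge
  index theorem (the tree's theorem `hodgeIndex_surface_holds`; Hartshorne V Thm. 1.9, Rem. 1.9.1);
* `exists_nsProjection_free` — the Gram projector `π x = Σ_{k,j} (G⁻¹)_{jk} (∫_S x ∪ dⱼ) d_k` onto `N`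
  along `T = N^⊥ = {x | x ∪ d = 0 ∀ d ∈ N}`: `π(H²) ⊆ N`, `π|_N = id`, `π|_T = 0`, `x - π x ∈ T`, `π` maps
  rational classes to rational classes and preserves Hodge types (`N ⊆ H^{1,1}` by the tree's theorem
  `isOfHodgeType_of_mem_algebraicClasses_of_isSmoothProjective`; classes of type `≠ (1,1)` are
  orthogonal to `N` by type, `cupProduct_eq_zero_of_hodgeType`) — symbol for symbol the conclusion of the
  marked `exists_nsProjection` (`NikulinTwinTransportSquareTranscendental.lean`), WITHOUT the marking.

No definition, no named-fact hypothesis, no sorry. Prover seat ring2-b02 (gen 47).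

References: Hartshorne, *Algebraic Geometry*, V Thm. 1.9 and Rem. 1.9.1; Voisin, *Hodge Theory and
Complex Algebraic Geometry I*, §6.3.2 Thm. 6.32, Lemma 7.30, §11.3 Thm. 11.30; Huybrechts, *Lectures on K3
Surfaces*, Ch. 3 §2.2 and Lemma 3.3.1 (the K3 case).
-/

-- `Summit.HodgeConjecture.HodgeConjecture.Theorems` is the mandated namespace (single-conjunct summit),
-- which `linter.dupNamespace` flags; restated here so stand-alone elaboration is warning-free.
set_option linter.dupNamespace false

noncomputable section

namespace Summit.HodgeConjecture.HodgeConjecture.Theorems.NikulinTwinTransport.SquareGlueFree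

open CategoryTheory MonoidalCategory CartesianMonoidalCategory
open Literature.AlgebraicGeometry.Motives Literature.AlgebraicGeometry.HodgeTheory
open Literature.AlgebraicTopology.SingularHomology

variable {S : SchemeOver ℂ}

/-! ### A rational basis of `N¹H²` with invertible Gram matrix (Hodge index) -/

/-- **A rational basis of the Néron–Severi classes with invertible intersection matrix.** For a smooth
projective complex surface `S`, `N = algebraicClasses S 1 ⊆ H²(S(ℂ); ℂ)` has a `ℂ`-basis `d₁, …, d_r` of
rational classes (algebraic classes are spanned by rational ones,
`span_isRationalClass_eq_top_of_isSmoothProjective_holds`) and a rational matrix `M = G⁻¹` inverse to the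
Gram matrix `G = (∫_S dᵢ ∪ dⱼ)`: `G` is injective on rational row vectors because a rational class of `N`
cup-orthogonal to `N` is orthogonal to the ample class `h` and to itself, so vanishes by the Hodge index
theorem (`hodgeIndex_surface_holds`). [cite: Hartshorne1977, V Thm. 1.9 and Rem. 1.9.1]
[cite: VoisinHodgeI2002, §6.3.2 Thm. 6.32] -/
theorem exists_neronSeveri_gramBasis (hS : IsSmoothProjective 2 S) :
    ∃ (r : ℕ) (d : Fin r → complexBetti S (2 * 1)) (M : Matrix (Fin r) (Fin r) ℚ),
      (∀ i, IsRationalClass (d i)) ∧ (∀ i, d i ∈ algebraicClasses S 1) ∧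
      LinearIndependent ℂ d ∧ Submodule.span ℂ (Set.range d) = algebraicClasses S 1 ∧
      (∀ i k, ∑ j, traceC hS (cupProduct (rfl : 2 * 1 + 2 * 1 = 2 * 2) (d i) (d j)) * ((M j k : ℚ) : ℂ) =
        if i = k then 1 else 0) ∧
      (∀ j i, ∑ k, ((M j k : ℚ) : ℂ) * traceC hS (cupProduct (rfl : 2 * 1 + 2 * 1 = 2 * 2) (d k) (d i)) =
        if j = i then 1 else 0) := by
  classical
  have h4 : 2 * 1 + 2 * 1 = 2 * 2 := rfl
  haveI : Module.Finite ℂ (complexBetti S (2 * 1)) := finite_complexBetti hS (2 * 1)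
  set N : Submodule ℂ (complexBetti S (2 * 1)) := algebraicClasses S 1 with hNdef
  -- the rational classes of `N` and a `ℂ`-basis of their span taken among them
  set S₀ : Set (complexBetti S (2 * 1)) := {c | IsRationalClass c ∧ c ∈ N} with hS₀
  obtain ⟨b, hbS, hbspan, hbli⟩ := exists_linearIndependent ℂ S₀
  have hbfin : b.Finite := hbli.setFinite
  haveI : Fintype b := hbfin.fintype
  obtain ⟨r, ⟨e⟩⟩ : ∃ r, Nonempty (b ≃ Fin r) := ⟨Fintype.card b, ⟨Fintype.equivFin b⟩⟩
  let d : Fin r → complexBetti S (2 * 1) := fun i ↦ (e.symm i : complexBetti S (2 * 1))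
  have hdli : LinearIndependent ℂ d := hbli.comp e.symm e.symm.injective
  have hdQ : ∀ i, IsRationalClass (d i) := fun i ↦ (hbS (e.symm i).2).1
  have hdN : ∀ i, d i ∈ N := fun i ↦ (hbS (e.symm i).2).2
  have hrange : Set.range d = b := by
    ext x
    constructor
    · rintro ⟨i, rfl⟩
      exact (e.symm i).2
    · intro hx
      exact ⟨e ⟨x, hx⟩, by simp [d]⟩
  -- `span d = N`: `N` is spanned by its rational classes
  have hspanN : Submodule.span ℂ (Set.range d) = N := by
    rw [hrange, hbspan]
    refine le_antisymm (Submodule.span_le.2 fun c hc ↦ hc.2) ?_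
    have h := span_isRationalClass_eq_top_of_isSmoothProjective_holds.supportedClasses_eq_span hS (2 * 1) 1
    intro c hc
    have hc' : c ∈ Submodule.span ℂ {c : complexBetti S (2 * 1) |
        IsRationalClass c ∧ c ∈ supportedClasses S (2 * 1) 1} := by rw [← h]; exact hc
    exact Submodule.span_mono (fun x hx ↦ hx) hc'
  have hmemS : ∀ a ∈ N, a ∈ Submodule.span ℂ (Set.range d) := fun a ha ↦ by rw [hspanN]; exact ha
  -- the rational Gram matrix `G = (∫ dᵢ ∪ dⱼ)`
  have hrat : ∀ i j, ∃ a : singularCohomology ℚ ℚ (ComplexPoints S) (2 * 2),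
      singularCohomology.ringChange (algebraMap ℚ ℂ) (ComplexPoints S) (2 * 2) a =
        cupProduct h4 (d i) (d j) :=
    fun i j ↦ ((hdQ i).cup h4 (hdQ j)).exists_ringChange_eq
  choose ρ hρ using hrat
  let G : Matrix (Fin r) (Fin r) ℚ := Matrix.of fun i j ↦ trace hS (ρ i j)
  have hG : ∀ i j, ((G i j : ℚ) : ℂ) = traceC hS (cupProduct h4 (d i) (d j)) := by
    intro i j
    simp only [G, Matrix.of_apply]
    rw [← hρ, traceC_ringChange, eq_ratCast]
  -- Hodge index: `G` is injective on rational row vectors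
  obtain ⟨h, hhQ, -, hhN, -, hidx⟩ := hodgeIndex_surface_holds (X := S) hS
  have hker : ∀ q : Fin r → ℚ, Matrix.vecMul q G = 0 → q = 0 := by
    intro q hq
    set c : complexBetti S (2 * 1) := ∑ i, ((q i : ℚ) : ℂ) • d i with hc
    have hcQ : IsRationalClass c := isRationalClass_sum _ _ fun i _ ↦ (hdQ i).smul (q i)
    have hcN : c ∈ N := Submodule.sum_mem _ fun i _ ↦ Submodule.smul_mem _ _ (hdN i)
    have hcs : ∀ j, cupProduct h4 c (d j) = 0 := by
      intro j
      apply eq_zero_of_traceC_eq_zero hS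
      have hqj : (((Matrix.vecMul q G) j : ℚ) : ℂ) = 0 := by rw [hq, Pi.zero_apply, Rat.cast_zero]
      rw [Matrix.vecMul, dotProduct, Rat.cast_sum] at hqj
      simp only [Rat.cast_mul, hG] at hqj
      rw [hc, map_sum, LinearMap.sum_apply, map_sum, ← hqj]
      refine Finset.sum_congr rfl fun i _ ↦ ?_
      rw [map_smul, LinearMap.smul_apply, map_smul, smul_eq_mul]
    have hca : ∀ a ∈ N, cupProduct h4 c a = 0 := by
      intro a ha
      refine Submodule.span_induction (p := fun a _ ↦ cupProduct h4 c a = 0) ?_ ?_ ?_ ?_ (hmemS a ha)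
      · rintro _ ⟨j, rfl⟩
        exact hcs j
      · exact map_zero _
      · intro x y _ _ hx hy
        rw [map_add, hx, hy, add_zero]
      · intro t x _ hx
        rw [map_smul, hx, smul_zero]
    have hc0 : c = 0 := by
      by_contra hne
      exact hidx c hcQ hcN (hca h hhN) hne (hca c hcN)
    have hq0 := Fintype.linearIndependent_iff.1 hdli (fun i ↦ ((q i : ℚ) : ℂ)) (by rw [← hc]; exact hc0)
    funext i
    exact_mod_cast hq0 i
  have hGinj : Function.Injective G.vecMul := by
    intro q q' hqq'
    have hqq : Matrix.vecMul q G = Matrix.vecMul q' G := hqq'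
    rw [← sub_eq_zero]
    refine hker _ ?_
    rw [Matrix.sub_vecMul, hqq, sub_self]
  have hdet : IsUnit G.det := (Matrix.isUnit_iff_isUnit_det _).1 (Matrix.vecMul_injective_iff_isUnit.1 hGinj)
  -- complex forms of `G * G⁻¹ = 1` and `G⁻¹ * G = 1`
  have hmulinv : ∀ i k, ∑ j, ((G i j : ℚ) : ℂ) * ((G⁻¹ j k : ℚ) : ℂ) = if i = k then 1 else 0 := by
    intro i k
    have h := congrFun (congrFun (Matrix.mul_nonsing_inv G hdet) i) k
    rw [Matrix.mul_apply, Matrix.one_apply] at h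
    have h' := congrArg (fun q : ℚ ↦ (q : ℂ)) h
    simpa [Rat.cast_sum, Rat.cast_mul, apply_ite (fun q : ℚ ↦ (q : ℂ))] using h'
  have hinvmul : ∀ j i, ∑ k, ((G⁻¹ j k : ℚ) : ℂ) * ((G k i : ℚ) : ℂ) = if j = i then 1 else 0 := by
    intro j i
    have h := congrFun (congrFun (Matrix.nonsing_inv_mul G hdet) j) i
    rw [Matrix.mul_apply, Matrix.one_apply] at h
    have h' := congrArg (fun q : ℚ ↦ (q : ℂ)) h
    simpa [Rat.cast_sum, Rat.cast_mul, apply_ite (fun q : ℚ ↦ (q : ℂ))] using h'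
  refine ⟨r, d, G⁻¹, hdQ, hdN, hdli, hspanN, fun i k ↦ ?_, fun j i ↦ ?_⟩
  · simp_rw [← hG]
    exact hmulinv i k
  · simp_rw [← hG]
    exact hinvmul j i

/-! ### The projection onto `N` along `T = N^⊥` -/

/-- **`H²(S(ℂ); ℂ) = N ⊕ T` for every smooth projective surface, and the projection `π_N` is a rational
Hodge endomorphism** — the marking-free form of `exists_nsProjection`. With `d`, `M = G⁻¹` as in
`exists_neronSeveri_gramBasis`, the Gram projector `π x = Σ_k (Σ_j M_{jk} ∫_S x ∪ dⱼ) d_k` takes values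
in `N = algebraicClasses S 1`, is the identity on `N`, kills `T = {t | t ∪ d = 0 ∀ d ∈ N}`, satisfies
`x - π x ∈ T`, maps rational classes to rational classes (`∫_S x ∪ dⱼ ∈ ℚ` for rational `x`), and
preserves every Hodge type: `N ⊆ H^{1,1}` (`isOfHodgeType_of_mem_algebraicClasses_of_isSmoothProjective`),
while a class of type `(i,j) ≠ (1,1)` is cup-orthogonal to `N` by type (`cupProduct_eq_zero_of_hodgeType`,
multiplicativity of types from de Rham's theorem `exists_deRhamIsoFamily_holds`), hence killed by `π`.
[cite: VoisinHodgeI2002, Lemma 7.30 and §11.3] [cite: Hartshorne1977, V Rem. 1.9.1] -/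
theorem exists_nsProjection_free (hS : IsSmoothProjective 2 S) :
    ∃ π : complexBetti S (2 * 1) →ₗ[ℂ] complexBetti S (2 * 1),
      (∀ x, π x ∈ algebraicClasses S 1) ∧
      (∀ d ∈ algebraicClasses S 1, π d = d) ∧
      (∀ t, (∀ d ∈ algebraicClasses S 1, cupProduct (rfl : 2 * 1 + 2 * 1 = 2 * 2) t d = 0) → π t = 0) ∧
      (∀ x, ∀ d ∈ algebraicClasses S 1, cupProduct (rfl : 2 * 1 + 2 * 1 = 2 * 2) (x - π x) d = 0) ∧
      (∀ x, IsRationalClass x → IsRationalClass (π x)) ∧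
      (∀ (i j : ℕ) x, IsOfHodgeType 2 S (2 * 1) i j x →
        IsOfHodgeType 2 S (2 * 1) i j (π x) ∧ IsOfHodgeType 2 S (2 * 1) i j (x - π x)) := by
  classical
  have h4 : 2 * 1 + 2 * 1 = 2 * 2 := rfl
  have hI := hodgePQ_independent_of_hodgeModel_holds
  obtain ⟨A⟩ := nonempty_hodgeModel_holds (n := 2) (X := S) hS
  have hcupS : CupPreservesHodgeType 2 S :=
    cupPreservesHodgeType_of_exists_deRhamIsoFamily hI hS A
      (Literature.NumberTheory.Transcendental.exists_deRhamIsoFamily_holds A.model)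
  have hN11 : ∀ d ∈ algebraicClasses S 1, IsOfHodgeType 2 S (2 * 1) 1 1 d :=
    fun d hd ↦ isOfHodgeType_of_mem_algebraicClasses_of_isSmoothProjective hS 1 hd
  set N : Submodule ℂ (complexBetti S (2 * 1)) := algebraicClasses S 1 with hNdef
  obtain ⟨r, d, M, hdQ, hdN, hdli, hspanN, hmulinv, hinvmul⟩ := exists_neronSeveri_gramBasis hS
  have hmemS : ∀ a ∈ N, a ∈ Submodule.span ℂ (Set.range d) := fun a ha ↦ by rw [hspanN]; exact ha
  -- the Gram projector
  let π : complexBetti S (2 * 1) →ₗ[ℂ] complexBetti S (2 * 1) :=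
    { toFun := fun x ↦ ∑ k, (∑ j, ((M j k : ℚ) : ℂ) * traceC hS (cupProduct h4 x (d j))) • d k
      map_add' := fun x y ↦ by
        rw [← Finset.sum_add_distrib]
        refine Finset.sum_congr rfl fun k _ ↦ ?_
        rw [← add_smul, ← Finset.sum_add_distrib]
        congr 1
        refine Finset.sum_congr rfl fun j _ ↦ ?_
        rw [map_add, LinearMap.add_apply, map_add, mul_add]
      map_smul' := fun t x ↦ by
        rw [RingHom.id_apply, Finset.smul_sum]
        refine Finset.sum_congr rfl fun k _ ↦ ?_
        rw [smul_smul, Finset.mul_sum]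
        congr 1
        refine Finset.sum_congr rfl fun j _ ↦ ?_
        rw [map_smul, LinearMap.smul_apply, map_smul, smul_eq_mul]
        ring }
  have hπ : ∀ x, π x = ∑ k, (∑ j, ((M j k : ℚ) : ℂ) * traceC hS (cupProduct h4 x (d j))) • d k :=
    fun x ↦ rfl
  -- values in `N`
  have hπN : ∀ x, π x ∈ N := fun x ↦ by
    rw [hπ]
    exact Submodule.sum_mem _ fun k _ ↦ Submodule.smul_mem _ _ (hdN k)
  -- identity on the basis, hence on `N`
  have hπd : ∀ i, π (d i) = d i := by
    intro i
    rw [hπ]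
    calc ∑ k, (∑ j, ((M j k : ℚ) : ℂ) * traceC hS (cupProduct h4 (d i) (d j))) • d k
        = ∑ k, (if i = k then (1 : ℂ) else 0) • d k := by
          refine Finset.sum_congr rfl fun k _ ↦ ?_
          rw [← hmulinv i k]
          refine congrArg (· • d k) (Finset.sum_congr rfl fun j _ ↦ mul_comm _ _)
      _ = d i := by simp [ite_smul, Finset.sum_ite_eq]
  have hπN_id : ∀ a ∈ N, π a = a := by
    intro a ha
    refine Submodule.span_induction (p := fun a _ ↦ π a = a) ?_ ?_ ?_ ?_ (hmemS a ha)
    · rintro _ ⟨i, rfl⟩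
      exact hπd i
    · exact map_zero _
    · intro x y _ _ hx hy
      rw [map_add, hx, hy]
    · intro t x _ hx
      rw [map_smul, hx]
  -- kills `T`
  have hπT : ∀ t, (∀ a ∈ N, cupProduct h4 t a = 0) → π t = 0 := by
    intro t ht
    rw [hπ]
    refine Finset.sum_eq_zero fun k _ ↦ ?_
    rw [Finset.sum_eq_zero fun j _ ↦ ?_, zero_smul]
    rw [ht (d j) (hdN j), map_zero, mul_zero]
  -- `x - π x ∈ T`
  have hπorth : ∀ x, ∀ a ∈ N, cupProduct h4 (x - π x) a = 0 := by
    intro x a ha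
    have hxd : ∀ i, cupProduct h4 (x - π x) (d i) = 0 := by
      intro i
      apply eq_zero_of_traceC_eq_zero hS
      rw [map_sub, LinearMap.sub_apply, map_sub, hπ, map_sum, LinearMap.sum_apply, map_sum]
      simp_rw [map_smul, LinearMap.smul_apply, map_smul, smul_eq_mul]
      -- `Σ_k (Σ_j M_{jk} ∫ x ∪ dⱼ) ∫ d_k ∪ dᵢ = Σ_j (∫ x ∪ dⱼ) (Σ_k M_{jk} ∫ d_k ∪ dᵢ) = ∫ x ∪ dᵢ`
      rw [sub_eq_zero]
      symm
      calc ∑ k, (∑ j, ((M j k : ℚ) : ℂ) * traceC hS (cupProduct h4 x (d j))) *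
              traceC hS (cupProduct h4 (d k) (d i))
          = ∑ j, traceC hS (cupProduct h4 x (d j)) *
              ∑ k, ((M j k : ℚ) : ℂ) * traceC hS (cupProduct h4 (d k) (d i)) := by
            simp_rw [Finset.sum_mul, Finset.mul_sum]
            rw [Finset.sum_comm]
            refine Finset.sum_congr rfl fun j _ ↦ Finset.sum_congr rfl fun k _ ↦ by ring
        _ = ∑ j, traceC hS (cupProduct h4 x (d j)) * (if j = i then (1 : ℂ) else 0) := by
            refine Finset.sum_congr rfl fun j _ ↦ by rw [hinvmul j i]
        _ = traceC hS (cupProduct h4 x (d i)) := by simp [Finset.sum_ite_eq']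
    refine Submodule.span_induction (p := fun a _ ↦ cupProduct h4 (x - π x) a = 0) ?_ ?_ ?_ ?_ (hmemS a ha)
    · rintro _ ⟨i, rfl⟩
      exact hxd i
    · exact map_zero _
    · intro u v _ _ hu hv
      rw [map_add, hu, hv, add_zero]
    · intro t u _ hu
      rw [map_smul, hu, smul_zero]
  -- rationality
  have hπQ : ∀ x, IsRationalClass x → IsRationalClass (π x) := by
    intro x hx
    have hrat : ∀ j, ∃ a : singularCohomology ℚ ℚ (ComplexPoints S) (2 * 2),
        singularCohomology.ringChange (algebraMap ℚ ℂ) (ComplexPoints S) (2 * 2) a = cupProduct h4 x (d j) :=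
      fun j ↦ (hx.cup h4 (hdQ j)).exists_ringChange_eq
    choose ρ hρ using hrat
    have hcoef : ∀ k, (∑ j, ((M j k : ℚ) : ℂ) * traceC hS (cupProduct h4 x (d j))) =
        (((∑ j, M j k * trace hS (ρ j) : ℚ)) : ℂ) := by
      intro k
      rw [Rat.cast_sum]
      refine Finset.sum_congr rfl fun j _ ↦ ?_
      rw [Rat.cast_mul, ← hρ j, traceC_ringChange, eq_ratCast]
    rw [hπ]
    refine isRationalClass_sum _ _ fun k _ ↦ ?_
    rw [hcoef k]
    exact (hdQ k).smul _
  -- Hodge types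
  have hπtyp : ∀ (i j : ℕ) x, IsOfHodgeType 2 S (2 * 1) i j x →
      IsOfHodgeType 2 S (2 * 1) i j (π x) ∧ IsOfHodgeType 2 S (2 * 1) i j (x - π x) := by
    intro i j x hx
    by_cases hij : i = 1 ∧ j = 1
    · obtain ⟨rfl, rfl⟩ := hij
      have h1 : IsOfHodgeType 2 S (2 * 1) 1 1 (π x) := hN11 _ (hπN x)
      exact ⟨h1, hx.sub hS h1⟩
    · -- classes of type `≠ (1,1)` are orthogonal to `N`
      have hxT : ∀ a ∈ N, cupProduct h4 x a = 0 := by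
        intro a ha
        exact cupProduct_eq_zero_of_hodgeType hI hS A hcupS h4 (by omega)
          ((hI.isOfHodgeType_iff hS A).1 hx) ((hI.isOfHodgeType_iff hS A).1 (hN11 a ha))
      have h0 : π x = 0 := hπT x hxT
      rw [h0, sub_zero]
      exact ⟨IsOfHodgeType.zero A _ _ _, hx⟩
  exact ⟨π, hπN, hπN_id, hπT, hπorth, hπQ, hπtyp⟩

end Summit.HodgeConjecture.HodgeConjecture.Theorems.NikulinTwinTransport.SquareGlueFree

end
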